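import Literature.NumberTheory.Sieve.LinearEquationsInPrimesInverseU2
import Literature.NumberTheory.Sieve.LinearEquationsInPrimesProductNilmanifold
import HarnessLib

/-!
# Route `GreenTaoLevelTwo`, crux `GITwo` (stmt-Parity-21275), line `birth`: the circle-factor
# cutoff for the transfer stub `stub_cyclicToInterval`

Second helper file of the passage `U³(ℤ/N'ℤ)`-inverse theorem ⇒ `U³[N]` inverse datum
(Green–Tao 2010, Prop. 8.4 from Green–Tao 2008a Thm. 12.8, "absorbing the wrap-around interval
cutoffs into a circle factor").  An interval piece `∑_{m ∈ [a,b]} f(m) F(gᵐ x)` of the re-indexed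
cyclic correlation is read over all of `[N]` against the CUTOFF NILSEQUENCE
`ψ(m/N' + ℤ)`, `ψ(θ) = max(min(1 + K(ρ − d(θ, c + ℤ)), 1), 0)` on `ℝ/ℤ`
(`c = (a+b)/2N'`, `ρ = (b−a)/2N'`), which is `1`-bounded and `K`-Lipschitz for the circle metric,
equals `1` at the points `m/N'`, `m ∈ [a,b]`, and vanishes at `m/N'` once `m ∈ [N]` is at integer
distance `≥ N'/K` from `[a,b]`; hence replacing `1_{[a,b]}(m)` by `ψ(m/N')` costs at most `2N'/K`
terms (§2, a statement about sequences).  §3: on a product nilmanifold `X × Y` (max metric) the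
tensor `F ⊗ ψ` of an `M`-Lipschitz `F` and a `K`-Lipschitz `ψ` (both `1`-bounded) is `1`-bounded and
`(M + K)`-Lipschitz, and its orbit under `(g, g')` from `(x, y)` is the product of the two orbits.
No new definitions (the cutoff is written out).

References: B. Green, T. Tao, *Linear equations in primes*, Ann. of Math. 171 (2010), §8
(Prop. 8.4) and App. B (Lemma B.5) [GreenTao2010]; B. Green, T. Tao, *An inverse theorem for the
Gowers U³(G) norm*, Proc. Edinb. Math. Soc. 51 (2008), §12 (Lemma "prod-lipschitz": tensoring
nilsequences) [GreenTao2008U3Inverse].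
-/

noncomputable section

open Literature.NumberTheory.Sieve

namespace Summit.Parity.GeneralizedHardyLittlewood.GreenTaoLevelTwoGITwoCyclicToInterval

/-! ### §1 The cutoff `ψ(θ) = max(min(1 + K(ρ − d(θ, c + ℤ)), 1), 0)` on the circle nilmanifold -/

/-- The cutoff is `1`-bounded and `K`-Lipschitz for the circle metric (`K ≥ 0`).
[cite: GreenTao2008U3Inverse, §12] -/
theorem cutoff_isBoundedLipschitz {K : ℝ} (hK : 0 ≤ K) (ρ c : ℝ) :
    Nilmanifold.circle.IsBoundedLipschitz K
      (fun θ => max (min (1 + K * (ρ - Nilmanifold.circle.dist θ (circlePt c))) 1) 0) := by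
  refine ⟨fun θ => ?_, fun θ θ' => ?_⟩
  · show |max (min (1 + K * (ρ - Nilmanifold.circle.dist θ (circlePt c))) 1) 0| ≤ 1
    rw [abs_le]
    constructor
    · linarith [le_max_right (min (1 + K * (ρ - Nilmanifold.circle.dist θ (circlePt c))) 1) 0]
    · exact max_le (min_le_right _ _) zero_le_one
  · show |max (min (1 + K * (ρ - Nilmanifold.circle.dist θ (circlePt c))) 1) 0 -
        max (min (1 + K * (ρ - Nilmanifold.circle.dist θ' (circlePt c))) 1) 0| ≤
      K * Nilmanifold.circle.dist θ θ'
    have h1 := abs_max_sub_max_le_abs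
      (min (1 + K * (ρ - Nilmanifold.circle.dist θ (circlePt c))) 1)
      (min (1 + K * (ρ - Nilmanifold.circle.dist θ' (circlePt c))) 1) 0
    have h2 := abs_min_sub_min_le_max (1 + K * (ρ - Nilmanifold.circle.dist θ (circlePt c))) 1
      (1 + K * (ρ - Nilmanifold.circle.dist θ' (circlePt c))) 1
    rw [sub_self, abs_zero] at h2
    have h3 : |(1 + K * (ρ - Nilmanifold.circle.dist θ (circlePt c))) -
        (1 + K * (ρ - Nilmanifold.circle.dist θ' (circlePt c)))| ≤
        K * Nilmanifold.circle.dist θ θ' := by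
      have e : (1 + K * (ρ - Nilmanifold.circle.dist θ (circlePt c))) -
          (1 + K * (ρ - Nilmanifold.circle.dist θ' (circlePt c))) =
          K * (Nilmanifold.circle.dist θ' (circlePt c) - Nilmanifold.circle.dist θ (circlePt c)) := by
        ring
      rw [e, abs_mul, abs_of_nonneg hK]
      refine mul_le_mul_of_nonneg_left ?_ hK
      have t1 := Nilmanifold.circle.dist_triangle θ' θ (circlePt c)
      have t2 := Nilmanifold.circle.dist_triangle θ θ' (circlePt c)
      rw [Nilmanifold.circle.dist_comm θ' θ] at t1
      rw [abs_le]; constructor <;> linarith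
    calc _ ≤ _ := h1
      _ ≤ max |(1 + K * (ρ - Nilmanifold.circle.dist θ (circlePt c))) -
            (1 + K * (ρ - Nilmanifold.circle.dist θ' (circlePt c)))| 0 := h2
      _ = |(1 + K * (ρ - Nilmanifold.circle.dist θ (circlePt c))) -
            (1 + K * (ρ - Nilmanifold.circle.dist θ' (circlePt c)))| :=
          max_eq_left (abs_nonneg _)
      _ ≤ K * Nilmanifold.circle.dist θ θ' := h3

/-- The cutoff takes values in `[0, 1]`. [folklore] -/
theorem cutoff_mem_unitInterval (K ρ c : ℝ) (θ : Nilmanifold.circle.G ⧸ Nilmanifold.circle.Γ) :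
    0 ≤ max (min (1 + K * (ρ - Nilmanifold.circle.dist θ (circlePt c))) 1) 0 ∧
      max (min (1 + K * (ρ - Nilmanifold.circle.dist θ (circlePt c))) 1) 0 ≤ 1 :=
  ⟨le_max_right _ _, max_le (min_le_right _ _) zero_le_one⟩

/-- The circle distance between two lattice points `u/N'`, `v/N'` at real distance `< 1/2` is the
real distance. [folklore] -/
theorem circle_dist_circlePt_of_lt {x y : ℝ} (h : |x - y| < 1 / 2) :
    Nilmanifold.circle.dist (circlePt x) (circlePt y) = |x - y| := by
  rw [circle_dist_circlePt,
    round_eq_zero_iff.2 ⟨by linarith [(abs_lt.1 h).1], (abs_lt.1 h).2⟩, Int.cast_zero, sub_zero]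

/-- **The cutoff is `1` on the interval**: for `1 ≤ a ≤ m ≤ b ≤ N`, `2N < N'`, with centre
`c = (a + b)/(2N')` and radius `ρ = (b − a)/(2N')`, `ψ(m/N') = 1`.
[cite: GreenTao2010, App. B, proof of Lemma B.5] -/
theorem cutoff_eq_one {N N' : ℕ} {a b m : ℤ} (hNN' : 2 * N < N') (ha : 1 ≤ a) (hb : b ≤ N)
    (ham : a ≤ m) (hmb : m ≤ b) {K : ℝ} (hK : 0 ≤ K) :
    max (min (1 + K * (((b - a : ℝ)) / (2 * N') -
      Nilmanifold.circle.dist (circlePt ((m : ℝ) / N')) (circlePt (((a + b : ℝ)) / (2 * N'))))) 1)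
      0 = 1 := by
  have hN'pos : (0 : ℝ) < N' := by exact_mod_cast (show 0 < N' by omega)
  have hNN'r : 2 * (N : ℝ) < N' := by exact_mod_cast hNN'
  have har : (1 : ℝ) ≤ a := by exact_mod_cast ha
  have hbr : (b : ℝ) ≤ N := by exact_mod_cast hb
  have hamr : (a : ℝ) ≤ m := by exact_mod_cast ham
  have hmbr : (m : ℝ) ≤ b := by exact_mod_cast hmb
  have e : (m : ℝ) / N' - (a + b : ℝ) / (2 * N') = (2 * m - a - b) / (2 * N') := by
    field_simp; ring
  have hlt : |(m : ℝ) / N' - (a + b : ℝ) / (2 * N')| < 1 / 2 := by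
    rw [e, abs_div, abs_of_pos (by positivity : (0 : ℝ) < 2 * N'), div_lt_iff₀ (by positivity),
      abs_lt]
    constructor <;> nlinarith
  rw [circle_dist_circlePt_of_lt hlt, e, abs_div, abs_of_pos (by positivity : (0 : ℝ) < 2 * N')]
  have hle : |(2 * m - a - b : ℝ)| / (2 * N') ≤ (b - a : ℝ) / (2 * N') := by
    refine div_le_div_of_nonneg_right ?_ (by positivity)
    rw [abs_le]; constructor <;> linarith
  have h1 : 1 ≤ 1 + K * ((b - a : ℝ) / (2 * N') - |(2 * m - a - b : ℝ)| / (2 * N')) := by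
    have := mul_nonneg hK (sub_nonneg.mpr hle)
    linarith
  rw [min_eq_right h1, max_eq_left (zero_le_one : (0 : ℝ) ≤ 1)]

/-- **The cutoff vanishes far from the interval**: for `m ∈ [N]` with `m < a`, `a − m ≥ N'/K`
(or `m > b`, `m − b ≥ N'/K`), `K > 0`, `ψ(m/N') = 0`. [cite: GreenTao2010, App. B, proof of Lemma B.5] -/
theorem cutoff_eq_zero {N N' : ℕ} {a b m : ℤ} (hNN' : 2 * N < N') (ha : 1 ≤ a) (hab : a ≤ b)
    (hb : b ≤ N) (hm1 : 1 ≤ m) (hmN : m ≤ N) {K : ℝ} (hK : 0 < K)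
    (hfar : (m < a ∧ (N' : ℝ) / K ≤ (a - m : ℝ)) ∨ (b < m ∧ (N' : ℝ) / K ≤ (m - b : ℝ))) :
    max (min (1 + K * (((b - a : ℝ)) / (2 * N') -
      Nilmanifold.circle.dist (circlePt ((m : ℝ) / N')) (circlePt (((a + b : ℝ)) / (2 * N'))))) 1)
      0 = 0 := by
  have hN'pos : (0 : ℝ) < N' := by exact_mod_cast (show 0 < N' by omega)
  have hNN'r : 2 * (N : ℝ) < N' := by exact_mod_cast hNN'
  have har : (1 : ℝ) ≤ a := by exact_mod_cast ha
  have hbr : (b : ℝ) ≤ N := by exact_mod_cast hb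
  have habr : (a : ℝ) ≤ b := by exact_mod_cast hab
  have hm1r : (1 : ℝ) ≤ m := by exact_mod_cast hm1
  have hmNr : (m : ℝ) ≤ N := by exact_mod_cast hmN
  have e : (m : ℝ) / N' - (a + b : ℝ) / (2 * N') = (2 * m - a - b) / (2 * N') := by
    field_simp; ring
  have hlt : |(m : ℝ) / N' - (a + b : ℝ) / (2 * N')| < 1 / 2 := by
    rw [e, abs_div, abs_of_pos (by positivity : (0 : ℝ) < 2 * N'), div_lt_iff₀ (by positivity),
      abs_lt]
    constructor <;> nlinarith
  rw [circle_dist_circlePt_of_lt hlt, e, abs_div, abs_of_pos (by positivity : (0 : ℝ) < 2 * N')]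
  -- `|2m − a − b| ≥ (b − a) + 2N'/K`
  have hK' : (N' : ℝ) ≤ K * ((|(2 * m - a - b : ℝ)| - (b - a)) / 2) := by
    rcases hfar with ⟨hma, hd⟩ | ⟨hbm, hd⟩
    · have hmar : (m : ℝ) < a := by exact_mod_cast hma
      rw [abs_of_neg (by linarith)]
      have : (N' : ℝ) ≤ K * (a - m : ℝ) := by rwa [div_le_iff₀' hK] at hd
      nlinarith
    · have hbmr : (b : ℝ) < m := by exact_mod_cast hbm
      rw [abs_of_pos (by linarith)]
      have : (N' : ℝ) ≤ K * (m - b : ℝ) := by rwa [div_le_iff₀' hK] at hd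
      nlinarith
  have h0 : 1 + K * ((b - a : ℝ) / (2 * N') - |(2 * m - a - b : ℝ)| / (2 * N')) ≤ 0 := by
    have e2 : 1 + K * ((b - a : ℝ) / (2 * N') - |(2 * m - a - b : ℝ)| / (2 * N')) =
        1 - (K * ((|(2 * m - a - b : ℝ)| - (b - a)) / 2)) / N' := by
      field_simp; ring
    rw [e2, sub_nonpos, le_div_iff₀ hN'pos, one_mul]
    exact hK'
  rw [max_eq_right]
  exact (min_le_left _ _).trans h0

/-! ### §2 Replacing the indicator of `[a, b]` by the cutoff costs at most `2N'/K` terms -/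

/-- **Cutoff error**: if `|t m| ≤ 1`, `0 ≤ w m ≤ 1`, `w m = 1` on `[a, b] ⊆ [1, N]` and `w m = 0`
for `m ∈ [N]` at integer distance `≥ N'/K` from `[a, b]` (`K > 0`), then
`|∑_{m ∈ [N]} t(m) w(m) − ∑_{m ∈ [N]} t(m) 1_{[a,b]}(m)| ≤ 2N'/K`.
[cite: GreenTao2010, App. B, proof of Lemma B.5] -/
theorem abs_sum_mul_sub_sum_indicator_le {N N' : ℕ} (hN' : 0 < N') {a b : ℤ} {K : ℝ}
    (hK : 0 < K) (t w : ℤ → ℝ) (ht : ∀ m, |t m| ≤ 1) (hw : ∀ m, 0 ≤ w m ∧ w m ≤ 1)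
    (hw1 : ∀ m : ℤ, a ≤ m → m ≤ b → w m = 1)
    (hw0 : ∀ m : ℤ, 1 ≤ m → m ≤ (N : ℤ) →
      (m < a ∧ (N' : ℝ) / K ≤ (a - m : ℝ)) ∨ (b < m ∧ (N' : ℝ) / K ≤ (m - b : ℝ)) → w m = 0) :
    |∑ m ∈ Finset.Icc (1 : ℤ) N, t m * w m -
        ∑ m ∈ Finset.Icc (1 : ℤ) N, t m * (if a ≤ m ∧ m ≤ b then 1 else 0)| ≤
      2 * N' / K := by
  classical
  set T : ℤ := ⌈(N' : ℝ) / K⌉ - 1 with hT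
  have hN'r : (0 : ℝ) < N' := by exact_mod_cast hN'
  have hT0 : 0 ≤ T := by
    have : 0 < ⌈(N' : ℝ) / K⌉ := Int.ceil_pos.mpr (by positivity)
    omega
  have hTle : (T : ℝ) ≤ (N' : ℝ) / K := by
    have := Int.ceil_lt_add_one ((N' : ℝ) / K)
    rw [hT]; push_cast; linarith
  -- pointwise: the difference is supported on the two fringes of width `T`
  set BAD : Finset ℤ := Finset.Icc (a - T) (a - 1) ∪ Finset.Icc (b + 1) (b + T) with hBAD
  have hpt : ∀ m ∈ Finset.Icc (1 : ℤ) N,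
      |t m * w m - t m * (if a ≤ m ∧ m ≤ b then 1 else 0)| ≤ if m ∈ BAD then 1 else 0 := by
    intro m hm
    obtain ⟨hm1, hmN⟩ := Finset.mem_Icc.mp hm
    by_cases hI : a ≤ m ∧ m ≤ b
    · rw [if_pos hI, hw1 m hI.1 hI.2, sub_self, abs_zero]
      split_ifs <;> norm_num
    · rw [if_neg hI, mul_zero, sub_zero]
      by_cases hfar : (m < a ∧ (N' : ℝ) / K ≤ (a - m : ℝ)) ∨ (b < m ∧ (N' : ℝ) / K ≤ (m - b : ℝ))
      · rw [hw0 m hm1 hmN hfar, mul_zero, abs_zero]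
        split_ifs <;> norm_num
      · -- near the interval: `m ∈ BAD`
        have hmem : m ∈ BAD := by
          rw [hBAD, Finset.mem_union, Finset.mem_Icc, Finset.mem_Icc]
          push Not at hI hfar
          rcases lt_or_ge m a with hma | hma
          · left
            have hd : ((a - m : ℤ) : ℝ) < (N' : ℝ) / K := by
              have := hfar.1 hma; push_cast; linarith
            have : a - m < ⌈(N' : ℝ) / K⌉ := Int.lt_ceil.mpr hd
            constructor <;> omega
          · right
            have hbm : b < m := hI hma
            have hd : ((m - b : ℤ) : ℝ) < (N' : ℝ) / K := by
              have := hfar.2 hbm; push_cast; linarith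
            have : m - b < ⌈(N' : ℝ) / K⌉ := Int.lt_ceil.mpr hd
            constructor <;> omega
        rw [if_pos hmem, abs_mul]
        calc |t m| * |w m| ≤ 1 * 1 :=
              mul_le_mul (ht m) (by rw [abs_of_nonneg (hw m).1]; exact (hw m).2) (abs_nonneg _)
                zero_le_one
          _ = 1 := one_mul 1
  rw [← Finset.sum_sub_distrib]
  calc |∑ m ∈ Finset.Icc (1 : ℤ) N, (t m * w m - t m * if a ≤ m ∧ m ≤ b then 1 else 0)|
      ≤ ∑ m ∈ Finset.Icc (1 : ℤ) N, |t m * w m - t m * if a ≤ m ∧ m ≤ b then 1 else 0| :=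
        Finset.abs_sum_le_sum_abs _ _
    _ ≤ ∑ m ∈ Finset.Icc (1 : ℤ) N, (if m ∈ BAD then (1 : ℝ) else 0) := Finset.sum_le_sum hpt
    _ = (((Finset.Icc (1 : ℤ) N).filter (fun m => m ∈ BAD)).card : ℝ) := by
        rw [Finset.sum_boole]
    _ ≤ (BAD.card : ℝ) := by
        exact_mod_cast Finset.card_le_card (fun m hm => (Finset.mem_filter.mp hm).2)
    _ ≤ ((Finset.Icc (a - T) (a - 1)).card : ℝ) + ((Finset.Icc (b + 1) (b + T)).card : ℝ) := by
        rw [hBAD]; exact_mod_cast Finset.card_union_le _ _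
    _ = T + T := by
        rw [Int.card_Icc, Int.card_Icc]
        have e1 : (a - 1 + 1 - (a - T)) = T := by ring
        have e2 : (b + T + 1 - (b + 1)) = T := by ring
        rw [e1, e2]
        have : ((T.toNat : ℕ) : ℝ) = (T : ℝ) := by exact_mod_cast Int.toNat_of_nonneg hT0
        rw [this]
    _ ≤ 2 * N' / K := by rw [two_mul, add_div]; exact add_le_add hTle hTle

/-! ### §3 Tensoring with the cutoff on a product nilmanifold -/

/-- **`F ⊗ ψ` on `X × Y`** (max metric): for `1`-bounded `F` (`M`-Lipschitz, `M ≥ 0`) and `ψ`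
(`K`-Lipschitz, `K ≥ 0`), `(p ↦ F(p₁) ψ(p₂))` is `1`-bounded and `(M + K)`-Lipschitz.
[cite: GreenTao2008U3Inverse, §12 (Lemma prod-lipschitz)] -/
theorem isBoundedLipschitz_tensor {s : ℕ} (X Y : Nilmanifold s) {M K : ℝ} (hM : 0 ≤ M)
    (hK : 0 ≤ K) {F : X.G ⧸ X.Γ → ℝ} {ψ : Y.G ⧸ Y.Γ → ℝ} (hF : X.IsBoundedLipschitz M F)
    (hψ : Y.IsBoundedLipschitz K ψ) :
    (X.prod Y).IsBoundedLipschitz (M + K)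
      (fun q => F (Nilmanifold.quotientProdMap X Y q).1 * ψ (Nilmanifold.quotientProdMap X Y q).2) := by
  refine ⟨fun q => ?_, fun p q => ?_⟩
  · show |F (Nilmanifold.quotientProdMap X Y q).1 * ψ (Nilmanifold.quotientProdMap X Y q).2| ≤ 1
    rw [abs_mul]
    calc |F _| * |ψ _| ≤ 1 * 1 := mul_le_mul (hF.1 _) (hψ.1 _) (abs_nonneg _) zero_le_one
      _ = 1 := one_mul 1
  · show |F (Nilmanifold.quotientProdMap X Y p).1 * ψ (Nilmanifold.quotientProdMap X Y p).2 -
        F (Nilmanifold.quotientProdMap X Y q).1 * ψ (Nilmanifold.quotientProdMap X Y q).2| ≤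
      (M + K) * (X.prod Y).dist p q
    set p₁ := (Nilmanifold.quotientProdMap X Y p).1
    set p₂ := (Nilmanifold.quotientProdMap X Y p).2
    set q₁ := (Nilmanifold.quotientProdMap X Y q).1
    set q₂ := (Nilmanifold.quotientProdMap X Y q).2
    have hd : (X.prod Y).dist p q = max (X.dist p₁ q₁) (Y.dist p₂ q₂) := rfl
    have e : F p₁ * ψ p₂ - F q₁ * ψ q₂ = (F p₁ - F q₁) * ψ p₂ + F q₁ * (ψ p₂ - ψ q₂) := by ring
    rw [e, hd]
    have hdX := X.dist_nonneg p₁ q₁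
    have hdY := Y.dist_nonneg p₂ q₂
    calc |(F p₁ - F q₁) * ψ p₂ + F q₁ * (ψ p₂ - ψ q₂)|
        ≤ |(F p₁ - F q₁) * ψ p₂| + |F q₁ * (ψ p₂ - ψ q₂)| := abs_add_le _ _
      _ ≤ M * X.dist p₁ q₁ * 1 + 1 * (K * Y.dist p₂ q₂) := by
          rw [abs_mul, abs_mul]
          exact add_le_add
            (mul_le_mul (hF.2 p₁ q₁) (hψ.1 _) (abs_nonneg _) (mul_nonneg hM hdX))
            (mul_le_mul (hF.1 _) (hψ.2 p₂ q₂) (abs_nonneg _) zero_le_one)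
      _ ≤ (M + K) * max (X.dist p₁ q₁) (Y.dist p₂ q₂) := by
          have h1 := le_max_left (X.dist p₁ q₁) (Y.dist p₂ q₂)
          have h2 := le_max_right (X.dist p₁ q₁) (Y.dist p₂ q₂)
          nlinarith

/-- The orbit of `(x, y)` under `(g, g')` on `X × Y`, read by `F ⊗ ψ`, is the product of the two
orbits (stated on `(G × G')/(Γ × Γ')`, which is the quotient of the product nilmanifold by
definition). [folklore] -/
theorem tensor_orbit {s : ℕ} (X Y : Nilmanifold s) (F : X.G ⧸ X.Γ → ℝ) (ψ : Y.G ⧸ Y.Γ → ℝ)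
    (g a : X.G) (g' b : Y.G) (n : ℕ) :
    F (Nilmanifold.quotientProdMap X Y (((g, g') : X.G × Y.G) ^ n •
        (QuotientGroup.mk (a, b) : (X.G × Y.G) ⧸ X.Γ.prod Y.Γ))).1 *
      ψ (Nilmanifold.quotientProdMap X Y (((g, g') : X.G × Y.G) ^ n •
        (QuotientGroup.mk (a, b) : (X.G × Y.G) ⧸ X.Γ.prod Y.Γ))).2 =
      F (g ^ n • (QuotientGroup.mk a : X.G ⧸ X.Γ)) * ψ (g' ^ n • (QuotientGroup.mk b : Y.G ⧸ Y.Γ)) := by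
  rw [Prod.pow_mk]
  rfl

end Summit.Parity.GeneralizedHardyLittlewood.GreenTaoLevelTwoGITwoCyclicToInterval

end
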